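import Summits.FinalStateConjecture.FinalStateConjecture.Theorems.ZeroEnergyKerrOrBombStationaryLimitReductionEquivariantPullback
import Summits.FinalStateConjecture.FinalStateConjecture.Theorems.ZeroEnergyKerrOrBombStationaryLimitReductionTimeEquivariantMaps
import Literature.Geometry.Lorentzian.StationaryFinalStateDecomposition
import Literature.Geometry.Lorentzian.KerrStarCoord
import HarnessLib

/-!
# Route ZeroEnergyKerrOrBomb · crux `StationaryLimitReduction` (stmt-FinalStateConjecture-10021), line
# `symplectic-dual-of-the-bomb` — Kerr–Schild slab pieces, conjugation by the motion, and the
# MODEL-SIDE near-zone convergence transfer of `stub_chartTransfer`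

Helper file (`--supports stmt-FinalStateConjecture-10021`; registered helper
`boostedKerr_truncSlab_pullback_tendsto_zero`) from the lead's wave-1 stub-worker for
`stub_chartTransfer` (lead prover-line-stmt-FinalStateConjecture-10021-a1-0, 2026-08-16). It
instantiates the abstract transfer `tendsto_supCkENorm_bilinPullback_translate_of_window`
(`…EquivariantPullback.lean`, p106055) on the data of the stub: an adapted chart `A` of a stationary
hole moved by the motion `(Λ, c₀)`, and a `T`-equivariant identification `Θ` of the Kerr–Schild region
`Kerr.region a r₀ ⊇ closure {r > r₊}` (the clauses of `IsKerrCharted`).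

* §1 Kerr–Schild slab pieces: `K_R = {t* = 0, r₊ ≤ r ≤ R}` is compact (`isCompact_kerrSlabPiece`), lies
  in `Kerr.region a r₀` for `max r₀ 0 < r₊` (`kerrSlabPiece_subset_region`), and its time translates
  contain the truncated slabs `{t* = τ, r₊ < r ≤ R}` (`kerrTruncSlab_subset_translate`).
* §2 The motion `P u = Λ u + c₀` (inverse of the tree's `poincareInv Λ c₀`) and conjugation:
  `Φ = P ∘ Θ ∘ P⁻¹` is smooth / equivariant (`Φ (x + s Λe₀) = Φ x + s (c Λe₀)`) / domain-respecting
  when `Θ` is (`contDiffOn_conj`, `conj_add_smul`, `mapsTo_conj`, `add_smul_mem_preimage_poincareInv`).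
* §3 The moved adapted background `A.background.boost Λ c₀`: its time `(P⁻¹ u)⁰` gains `c s` and its
  radius `A.radius (P⁻¹ u)` is unchanged along `u ↦ u + s (c Λe₀)`; its truncated slabs and those of
  `boostedKerrBackground Λ c₀ M a` as plain subsets of `E4`; the boosted Kerr–Schild truncated slab at
  time `τ` lies in the translate by `τ Λe₀` of the compact piece `P(K_R)`.
* §5 `conj_image_truncLateRegion_subset` — the re-adapted truncated world-tubes lie in the old ones
  (`{t* ∘ P⁻¹ > τ₁, r ∘ P⁻¹ ≤ R} ↦ {x⁰ ∘ P⁻¹ > cτ₁ + m, A.radius ∘ P⁻¹ ≤ R̃}` under `Φ`, all `τ₁`), so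
  the separation clause `exists_pairwise_disjoint` transfers (`Disjoint.mono`).
* §4 `tendsto_supCkENorm_boostedKerr_truncTimeSlab` / `boostedKerr_truncSlab_pullback_tendsto_zero`
  (registered, binder-free): if a field of bilinear forms `B` (the old metric deviation, extended) is `Cᵏ`
  on the moved adapted domain `P(A.domain)` and its `Cᵏ` sup norms over the moved ADAPTED truncated
  slabs `{x⁰ ∘ P⁻¹ = σ, A.radius ∘ P⁻¹ ≤ R̃}` tend to `0` (`σ → ∞`, every `R̃`: the clause
  `tendsto_truncDeviationCk` of the stationary decomposition), then the `Cᵏ` sup norms of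
  `bilinPullback Φ B` over the boosted KERR–SCHILD truncated slabs `{t* ∘ P⁻¹ = τ, r ∘ P⁻¹ ≤ R}` tend
  to `0` (`τ → ∞`, every `R`). What then remains of the near-zone clause of the transfer is the
  identification, on the boosted Kerr exterior, of the deviation of the re-adapted chart
  `ψ ∘ Φ` from `boostedKerrBilin` with `bilinPullback Φ B` (chain rule + the isometry clause of
  `IsKerrCharted`), which is manifold plumbing left to the stub.

Elementary; no named fact, nothing restated. References: Dafermos–Rodnianski arXiv:0811.0354, §5.1
(Kerr–Schild `t*`, `r`); DHRT arXiv:2104.08222, §1 (truncated slab norms); Petersen 2006, Ch. 10, §3.2.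
-/

-- every `Summit.FinalStateConjecture.FinalStateConjecture.…` name repeats the summit = sub-problem segment (D-0017 layout)
set_option linter.dupNamespace false

noncomputable section

open scoped Topology ENNReal Manifold ContDiff
open Set Filter Function

namespace Summit.FinalStateConjecture.FinalStateConjecture.Theorems.SymplecticDualOfTheBomb

open Literature.Geometry.Lorentzian

/-! ## §1 Kerr–Schild slab pieces -/

/-- **The slab piece `{t* = 0, r₁ ≤ r ≤ R}` is compact** for `r₁ > 0`: it is the image under
`y ↦ (0, y)` of a closed subset of the ball `‖y‖ ≤ R + |a|` of `E3` (`Kerr.norm_le_radius_add_abs`).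
[folklore] -/
theorem isCompact_kerrSlabPiece (a : ℝ) {r₁ : ℝ} (hr₁ : 0 < r₁) (R : ℝ) :
    IsCompact {x : E4 | E4.time x = 0 ∧ r₁ ≤ Kerr.radius a x ∧ Kerr.radius a x ≤ R} := by
  have heq : {x : E4 | E4.time x = 0 ∧ r₁ ≤ Kerr.radius a x ∧ Kerr.radius a x ≤ R} =
      E4.ofTimeSpace 0 '' {y : E3 | r₁ ≤ Kerr.radius a (E4.ofTimeSpace 0 y) ∧
        Kerr.radius a (E4.ofTimeSpace 0 y) ≤ R} := by
    ext x
    constructor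
    · rintro ⟨h0, h1, h2⟩
      refine ⟨E4.spatial x, ?_, ?_⟩
      · rw [mem_setOf_eq, Kerr.radius_ofTimeSpace_spatial]
        exact ⟨h1, h2⟩
      · have h := E4.ofTimeSpace_time_spatial x
        rwa [h0] at h
    · rintro ⟨y, ⟨h1, h2⟩, rfl⟩
      exact ⟨E4.time_ofTimeSpace 0 y, h1, h2⟩
  rw [heq]
  refine IsCompact.image (Metric.isCompact_of_isClosed_isBounded ?_ ?_) (E4.continuous_ofTimeSpace 0)
  · exact isClosed_Icc.preimage ((Kerr.continuous_radius a).comp (E4.continuous_ofTimeSpace 0))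
  · refine (Metric.isBounded_closedBall (x := (0 : E3)) (r := R + |a|)).subset fun y hy ↦ ?_
    have hr : 0 < Kerr.radius a (E4.ofTimeSpace 0 y) := hr₁.trans_le hy.1
    rw [Metric.mem_closedBall, dist_zero_right]
    linarith [Kerr.norm_le_radius_add_abs hr, hy.2]

/-- The slab piece `{t* = 0, r₁ ≤ r ≤ R}` lies in the Kerr–Schild region `{r > max r₀ 0}` as soon as
`max r₀ 0 < r₁` (for the transfer: `r₁ = r₊ > r₀`, the collar of `IsKerrCharted`). [folklore] -/
theorem kerrSlabPiece_subset_region (a : ℝ) {r₀ r₁ : ℝ} (h : max r₀ 0 < r₁) (R : ℝ) :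
    {x : E4 | E4.time x = 0 ∧ r₁ ≤ Kerr.radius a x ∧ Kerr.radius a x ≤ R} ⊆ (Kerr.region a r₀ : Set E4) :=
  fun _ hx ↦ Kerr.mem_region.2 (h.trans_le hx.2.1)

/-- The truncated Kerr–Schild slab `{t* = τ, r₁ < r ≤ R}` lies in the translate by `τ e₀` of the
slab piece `{t* = 0, r₁ ≤ r ≤ R}` (the radius does not depend on `t*`). [folklore] -/
theorem kerrTruncSlab_subset_translate (a r₁ R τ : ℝ) :
    {x : E4 | r₁ < Kerr.radius a x ∧ E4.time x = τ ∧ Kerr.radius a x ≤ R} ⊆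
      (fun x ↦ x + τ • E4.basisVector 0) ''
        {x : E4 | E4.time x = 0 ∧ r₁ ≤ Kerr.radius a x ∧ Kerr.radius a x ≤ R} := by
  rintro x ⟨h1, h2, h3⟩
  refine ⟨x + (-τ) • E4.basisVector 0, ⟨?_, ?_, ?_⟩, ?_⟩
  · rw [time_add_smul_basisVector_zero, h2]
    ring
  · rw [Kerr.radius_add_time_smul_basisVector]
    exact h1.le
  · rw [Kerr.radius_add_time_smul_basisVector]
    exact h3
  · show x + (-τ) • E4.basisVector 0 + τ • E4.basisVector 0 = x
    rw [add_assoc, ← add_smul, neg_add_cancel, zero_smul, add_zero]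

/-! ## §2 The motion `P u = Λ u + c₀` and conjugation of equivariant maps -/

section Motion

variable (Λ : lorentzGroup) (c₀ : E4)

/-- `P⁻¹ (P u) = u` for `P u = Λ u + c₀`, `P⁻¹ = poincareInv Λ c₀`. [folklore] -/
theorem poincareInv_apply_add (u : E4) : poincareInv Λ c₀ ((Λ : E4 ≃L[ℝ] E4) u + c₀) = u := by
  simp [poincareInv]

/-- `P (P⁻¹ x) = x`. [folklore] -/
theorem apply_poincareInv_add (x : E4) : (Λ : E4 ≃L[ℝ] E4) (poincareInv Λ c₀ x) + c₀ = x := by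
  simp [poincareInv]

/-- `P⁻¹` intertwines the moving translation `x ↦ x + s Λv` with `u ↦ u + s v`. [folklore] -/
theorem poincareInv_add_smul (x v : E4) (s : ℝ) :
    poincareInv Λ c₀ (x + s • (Λ : E4 ≃L[ℝ] E4) v) = poincareInv Λ c₀ x + s • v := by
  simp only [poincareInv, add_sub_right_comm, map_add, map_smul, ContinuousLinearEquiv.symm_apply_apply]

/-- `P⁻¹` is smooth (affine). [folklore] -/
theorem contDiff_poincareInv {n : WithTop ℕ∞} : ContDiff ℝ n (poincareInv Λ c₀) :=
  (Λ : E4 ≃L[ℝ] E4).symm.contDiff.comp (contDiff_id.sub contDiff_const)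

/-- `P` is continuous. [folklore] -/
theorem continuous_poincare : Continuous fun u : E4 ↦ (Λ : E4 ≃L[ℝ] E4) u + c₀ :=
  (Λ : E4 ≃L[ℝ] E4).continuous.add continuous_const

/-- A preimage under `P⁻¹` is an image under `P`. [folklore] -/
theorem preimage_poincareInv_eq_image (S : Set E4) :
    poincareInv Λ c₀ ⁻¹' S = (fun u : E4 ↦ (Λ : E4 ≃L[ℝ] E4) u + c₀) '' S := by
  ext x
  constructor
  · intro hx
    exact ⟨poincareInv Λ c₀ x, hx, apply_poincareInv_add Λ c₀ x⟩
  · rintro ⟨u, hu, rfl⟩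
    show poincareInv Λ c₀ _ ∈ S
    rwa [poincareInv_apply_add]

/-- A time-translation invariant set has a moved preimage invariant under `x ↦ x + s Λe₀`.
[folklore] -/
theorem add_smul_mem_preimage_poincareInv {S : Set E4}
    (hS : ∀ x ∈ S, ∀ s : ℝ, x + s • E4.basisVector 0 ∈ S) :
    ∀ x ∈ poincareInv Λ c₀ ⁻¹' S, ∀ s : ℝ,
      x + s • (Λ : E4 ≃L[ℝ] E4) (E4.basisVector 0) ∈ poincareInv Λ c₀ ⁻¹' S := fun x hx s ↦ by
  show poincareInv Λ c₀ _ ∈ S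
  rw [poincareInv_add_smul]
  exact hS _ hx s

/-- **Conjugation keeps equivariance**: if `Θ (x + s e₀) = Θ x + (c s) e₀` on `S`, then
`Φ = P ∘ Θ ∘ P⁻¹` satisfies `Φ (x + s Λe₀) = Φ x + s (c Λe₀)` on `P⁻¹⁻¹ S`. [folklore] -/
theorem conj_add_smul {S : Set E4} {Θ : E4 → E4} {c : ℝ}
    (hΘ : ∀ x ∈ S, ∀ s : ℝ, Θ (x + s • E4.basisVector 0) = Θ x + (c * s) • E4.basisVector 0) :
    ∀ x ∈ poincareInv Λ c₀ ⁻¹' S, ∀ s : ℝ,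
      (Λ : E4 ≃L[ℝ] E4) (Θ (poincareInv Λ c₀ (x + s • (Λ : E4 ≃L[ℝ] E4) (E4.basisVector 0)))) + c₀ =
        ((Λ : E4 ≃L[ℝ] E4) (Θ (poincareInv Λ c₀ x)) + c₀) +
          s • (c • (Λ : E4 ≃L[ℝ] E4) (E4.basisVector 0)) := fun x hx s ↦ by
  rw [poincareInv_add_smul, hΘ _ hx s, map_add, map_smul, smul_smul, mul_comm s c]
  abel

/-- Conjugation keeps smoothness. [folklore] -/
theorem contDiffOn_conj {S : Set E4} {Θ : E4 → E4} {n : WithTop ℕ∞} (hΘ : ContDiffOn ℝ n Θ S) :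
    ContDiffOn ℝ n (fun x ↦ (Λ : E4 ≃L[ℝ] E4) (Θ (poincareInv Λ c₀ x)) + c₀) (poincareInv Λ c₀ ⁻¹' S) :=
  ((Λ : E4 ≃L[ℝ] E4).contDiff.comp_contDiffOn
    (hΘ.comp (contDiff_poincareInv Λ c₀).contDiffOn (mapsTo_preimage _ _))).add contDiffOn_const

/-- Conjugation keeps the domain clause: `Θ(S) ⊆ D` gives `Φ(P⁻¹⁻¹ S) ⊆ P⁻¹⁻¹ D`. [folklore] -/
theorem mapsTo_conj {S D : Set E4} {Θ : E4 → E4} (h : MapsTo Θ S D) :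
    MapsTo (fun x ↦ (Λ : E4 ≃L[ℝ] E4) (Θ (poincareInv Λ c₀ x)) + c₀) (poincareInv Λ c₀ ⁻¹' S)
      (poincareInv Λ c₀ ⁻¹' D) := fun x hx ↦ by
  show poincareInv Λ c₀ _ ∈ D
  rw [poincareInv_apply_add]
  exact h hx

/-! ## §3 The moved adapted background and the boosted Kerr–Schild slabs as subsets of `E4` -/

variable {𝓑 : StationaryAFBlackHole.{0}} (A : 𝓑.AdaptedChart)

/-- The adapted radius does not depend on time: `A.radius (z + s e₀) = A.radius z`
(`AdaptedChart.radius_ofTimeSpace`). [folklore] -/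
theorem adaptedRadius_add_smul_basisVector (z : E4) (s : ℝ) :
    A.radius (z + s • E4.basisVector 0) = A.radius z := by
  have h1 : ∀ (t : ℝ) (y : E3),
      E4.ofTimeSpace t y + s • E4.basisVector 0 = E4.ofTimeSpace (t + s) y := fun t y ↦ by
    rw [← E4.ofTimeSpace_zero_add_smul y t, ← E4.ofTimeSpace_zero_add_smul y (t + s), add_assoc,
      ← add_smul]
  conv_lhs => rw [← E4.ofTimeSpace_time_spatial z, h1, A.radius_ofTimeSpace]
  conv_rhs => rw [← E4.ofTimeSpace_time_spatial z, A.radius_ofTimeSpace]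

/-- The moved adapted time `(P⁻¹ u)⁰` gains `c s` along `u ↦ u + s (c Λe₀)`. [folklore] -/
theorem movedTime_add_smul (c : ℝ) (u : E4) (s : ℝ) :
    (poincareInv Λ c₀ (u + s • (c • (Λ : E4 ≃L[ℝ] E4) (E4.basisVector 0)))) 0 =
      (poincareInv Λ c₀ u) 0 + c * s := by
  rw [smul_smul, poincareInv_add_smul]
  simp [mul_comm]

/-- The moved adapted radius `A.radius (P⁻¹ u)` is unchanged along `u ↦ u + s (c Λe₀)`. [folklore] -/
theorem movedRadius_add_smul (c : ℝ) (u : E4) (s : ℝ) :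
    A.radius (poincareInv Λ c₀ (u + s • (c • (Λ : E4 ≃L[ℝ] E4) (E4.basisVector 0)))) =
      A.radius (poincareInv Λ c₀ u) := by
  rw [smul_smul, poincareInv_add_smul, adaptedRadius_add_smul_basisVector]

/-- The moved adapted time is continuous. [folklore] -/
theorem continuous_movedTime : Continuous fun u : E4 ↦ (poincareInv Λ c₀ u) 0 :=
  (EuclideanSpace.proj (𝕜 := ℝ) (0 : Fin 4)).continuous.comp (continuous_poincareInv Λ c₀)

/-- The moved Euclidean radius (plus a constant) is continuous. [folklore] -/
theorem continuous_movedSpatialNorm_add (C : ℝ) :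
    Continuous fun u : E4 ↦ E4.spatialNorm (poincareInv Λ c₀ u) + C :=
  ((continuous_norm.comp E4.spatial.continuous).comp (continuous_poincareInv Λ c₀)).add continuous_const

/-- The truncated slabs of the moved adapted background as subsets of `E4`. [folklore] -/
theorem image_val_truncTimeSlab_boost (R σ : ℝ) :
    Subtype.val '' (A.background.boost Λ c₀).truncTimeSlab R σ =
      {u : E4 | u ∈ poincareInv Λ c₀ ⁻¹' (A.domain : Set E4) ∧
        (poincareInv Λ c₀ u) 0 = σ ∧ A.radius (poincareInv Λ c₀ u) ≤ R} := by
  ext u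
  constructor
  · rintro ⟨x, hx, rfl⟩
    exact ⟨x.2, hx.1, hx.2⟩
  · rintro ⟨hu, h1, h2⟩
    exact ⟨⟨u, hu⟩, ⟨h1, h2⟩, rfl⟩

/-- The truncated slabs of the boosted Kerr background as subsets of `E4`. [folklore] -/
theorem image_val_truncTimeSlab_boostedKerr (M a R τ : ℝ) :
    Subtype.val '' (boostedKerrBackground Λ c₀ M a).truncTimeSlab R τ =
      {x : E4 | x ∈ poincareInv Λ c₀ ⁻¹' (Kerr.exterior M a : Set E4) ∧
        (poincareInv Λ c₀ x) 0 = τ ∧ Kerr.radius a (poincareInv Λ c₀ x) ≤ R} := by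
  ext u
  constructor
  · rintro ⟨x, hx, rfl⟩
    exact ⟨x.2, hx.1, hx.2⟩
  · rintro ⟨hu, h1, h2⟩
    exact ⟨⟨u, hu⟩, ⟨h1, h2⟩, rfl⟩

/-- **The boosted Kerr–Schild truncated slab at time `τ` lies in the translate by `τ Λe₀` of the moved
compact slab piece `P({t* = 0, r₊ ≤ r ≤ R})`.** [folklore] -/
theorem truncTimeSlab_boostedKerr_subset_translate (M a R τ : ℝ) :
    Subtype.val '' (boostedKerrBackground Λ c₀ M a).truncTimeSlab R τ ⊆
      (fun x ↦ x + τ • (Λ : E4 ≃L[ℝ] E4) (E4.basisVector 0)) ''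
        ((fun u : E4 ↦ (Λ : E4 ≃L[ℝ] E4) u + c₀) ''
          {u : E4 | E4.time u = 0 ∧ Kerr.rPlus M a ≤ Kerr.radius a u ∧ Kerr.radius a u ≤ R}) := by
  rw [image_val_truncTimeSlab_boostedKerr]
  rintro x ⟨hx1, hx2, hx3⟩
  have hext : Kerr.rPlus M a < Kerr.radius a (poincareInv Λ c₀ x) :=
    (le_max_left _ _).trans_lt (Kerr.mem_exterior.1 hx1)
  obtain ⟨k, hk, hkx⟩ := kerrTruncSlab_subset_translate a (Kerr.rPlus M a) R τ ⟨hext, hx2, hx3⟩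
  refine ⟨(Λ : E4 ≃L[ℝ] E4) k + c₀, ⟨k, hk, rfl⟩, ?_⟩
  have hx : (Λ : E4 ≃L[ℝ] E4) (poincareInv Λ c₀ x) + c₀ = x := apply_poincareInv_add Λ c₀ x
  rw [← hkx, map_add, map_smul] at hx
  rw [← hx]
  abel

end Motion

/-! ## §4 Assembly: near-zone convergence transfers from the moved adapted slabs to the boosted
Kerr–Schild slabs -/

/-- **Model-side near-zone transfer.** Let `A` be an adapted chart of a stationary hole, `(Λ, c₀)` a
motion, and `Θ` a `C^{k+1}`, `T`-equivariant (`c > 0`) map of the Kerr–Schild region `{r > max r₀ 0}`,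
`r₀ < r₊`, `0 < r₊`, into `A.domain` (the clauses of `IsKerrCharted`); let `B` be a field of bilinear
forms which is `Cᵏ` on the moved domain `P(A.domain)` and whose `Cᵏ` sup norms over the moved adapted
truncated slabs `{x⁰ ∘ P⁻¹ = σ, A.radius ∘ P⁻¹ ≤ R̃}` tend to `0` as `σ → ∞` for every `R̃`. Then for
every `R` the `Cᵏ` sup norms of the pullback `bilinPullback Φ B`, `Φ = P ∘ Θ ∘ P⁻¹`, over the boosted
Kerr–Schild truncated slabs `{t* ∘ P⁻¹ = τ, r ∘ P⁻¹ ≤ R}` tend to `0` as `τ → ∞`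
(`tendsto_supCkENorm_bilinPullback_translate_of_window` on the compact piece `P({t* = 0, r₊ ≤ r ≤ R})`).
[folklore] -/
theorem tendsto_supCkENorm_boostedKerr_truncTimeSlab {𝓑 : StationaryAFBlackHole.{0}}
    (A : 𝓑.AdaptedChart) (Λ : lorentzGroup) (c₀ : E4) {M a c r₀ : ℝ} {Θ : E4 → E4} {k : ℕ}
    (hrp : 0 < Kerr.rPlus M a) (hr₀ : r₀ < Kerr.rPlus M a) (hc : 0 < c)
    (hΘs : ContDiffOn ℝ (k + 1) Θ (Kerr.region a r₀ : Set E4))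
    (hΘm : MapsTo Θ (Kerr.region a r₀ : Set E4) (A.domain : Set E4))
    (hΘe : ∀ x ∈ (Kerr.region a r₀ : Set E4), ∀ s : ℝ,
      Θ (x + s • E4.basisVector 0) = Θ x + (c * s) • E4.basisVector 0)
    {B : E4 → E4 →L[ℝ] E4 →L[ℝ] ℝ} (hB : ContDiffOn ℝ k B (poincareInv Λ c₀ ⁻¹' (A.domain : Set E4)))
    (hdev : ∀ Rt : ℝ, Tendsto
      (fun σ ↦ supCkENorm (Subtype.val '' (A.background.boost Λ c₀).truncTimeSlab Rt σ) k B)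
      atTop (𝓝 0))
    (R : ℝ) :
    Tendsto (fun τ : ℝ ↦ supCkENorm (Subtype.val '' (boostedKerrBackground Λ c₀ M a).truncTimeSlab R τ) k
      (bilinPullback (fun x ↦ (Λ : E4 ≃L[ℝ] E4) (Θ (poincareInv Λ c₀ x)) + c₀) B)) atTop (𝓝 0) := by
  obtain ⟨C, hC⟩ := A.exists_abs_radius_sub_spatialNorm_le
  -- the data of the abstract transfer
  have hs : IsOpen (poincareInv Λ c₀ ⁻¹' (Kerr.region a r₀ : Set E4)) :=
    (Kerr.region a r₀).isOpen.preimage (continuous_poincareInv Λ c₀)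
  have ht : IsOpen (poincareInv Λ c₀ ⁻¹' (A.domain : Set E4)) :=
    A.domain.isOpen.preimage (continuous_poincareInv Λ c₀)
  have hK : IsCompact ((fun u : E4 ↦ (Λ : E4 ≃L[ℝ] E4) u + c₀) ''
      {u : E4 | E4.time u = 0 ∧ Kerr.rPlus M a ≤ Kerr.radius a u ∧ Kerr.radius a u ≤ R}) :=
    (isCompact_kerrSlabPiece a hrp R).image (continuous_poincare Λ c₀)
  have hKs : (fun u : E4 ↦ (Λ : E4 ≃L[ℝ] E4) u + c₀) ''
      {u : E4 | E4.time u = 0 ∧ Kerr.rPlus M a ≤ Kerr.radius a u ∧ Kerr.radius a u ≤ R} ⊆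
        poincareInv Λ c₀ ⁻¹' (Kerr.region a r₀ : Set E4) := by
    rw [preimage_poincareInv_eq_image]
    exact image_mono (kerrSlabPiece_subset_region a (max_lt hr₀ hrp) R)
  have hdev' : ∀ Rt : ℝ, Tendsto (fun σ ↦ supCkENorm
      {u : E4 | u ∈ poincareInv Λ c₀ ⁻¹' (A.domain : Set E4) ∧ (poincareInv Λ c₀ u) 0 = σ ∧
        A.radius (poincareInv Λ c₀ u) ≤ Rt} k B) atTop (𝓝 0) := fun Rt ↦ by
    have h := hdev Rt
    simp_rw [image_val_truncTimeSlab_boost] at h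
    exact h
  have key := tendsto_supCkENorm_bilinPullback_translate_of_window hs (contDiffOn_conj Λ c₀ hΘs)
    (add_smul_mem_preimage_poincareInv Λ c₀ (kerrRegion_add_smul_mem a r₀)) (conj_add_smul Λ c₀ hΘe)
    hK hKs ht hB (mapsTo_conj Λ c₀ hΘm) (continuous_movedTime Λ c₀) hc
    (movedTime_add_smul Λ c₀ c) (continuous_movedSpatialNorm_add Λ c₀ C)
    (fun u ↦ by linarith [(abs_le.1 (hC (poincareInv Λ c₀ u))).2])
    (movedRadius_add_smul Λ c₀ A c) hdev'
  refine tendsto_of_tendsto_of_tendsto_of_le_of_le tendsto_const_nhds key (fun _ ↦ zero_le) fun τ ↦ ?_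
  exact supCkENorm_mono (truncTimeSlab_boostedKerr_subset_translate Λ c₀ M a R τ) k _

/-! ## §5 Separation: the re-adapted truncated world-tubes lie in the old ones -/

/-- The truncated LATE region of the boosted Kerr background as a subset of `E4`. [folklore] -/
theorem image_val_truncLateRegion_boostedKerr (Λ : lorentzGroup) (c₀ : E4) (M a τ₁ R : ℝ) :
    Subtype.val '' (boostedKerrBackground Λ c₀ M a).truncLateRegion τ₁ R =
      {x : E4 | x ∈ poincareInv Λ c₀ ⁻¹' (Kerr.exterior M a : Set E4) ∧
        τ₁ < (poincareInv Λ c₀ x) 0 ∧ Kerr.radius a (poincareInv Λ c₀ x) ≤ R} := by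
  ext u
  constructor
  · rintro ⟨x, hx, rfl⟩
    exact ⟨x.2, hx.1, hx.2⟩
  · rintro ⟨hu, h1, h2⟩
    exact ⟨⟨u, hu⟩, ⟨h1, h2⟩, rfl⟩

/-- **Tube containment (model side of the separation clause).** Under the hypotheses of
`tendsto_supCkENorm_boostedKerr_truncTimeSlab` on `(A, Λ, c₀, Θ)` (only continuity of `Θ` is used),
for every `R` there are `m, R̃` such that for EVERY `τ₁` the conjugated map `Φ = P ∘ Θ ∘ P⁻¹` carries the
boosted Kerr–Schild truncated world-tube `{t* ∘ P⁻¹ > τ₁, r ∘ P⁻¹ ≤ R}` into the moved adapted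
truncated world-tube `{x⁰ ∘ P⁻¹ > c τ₁ + m, A.radius ∘ P⁻¹ ≤ R̃}`; so the new truncated tubes of the
re-adapted charts `ψᵢ ∘ Φᵢ` are images of subsets of the old ones, and the separation clause
`exists_pairwise_disjoint` transfers (with `τ₁' = maxᵢ (τ₁ − mᵢ)/cᵢ`, `R̃ = maxᵢ R̃ᵢ`). [folklore] -/
theorem conj_image_truncLateRegion_subset {𝓑 : StationaryAFBlackHole.{0}}
    (A : 𝓑.AdaptedChart) (Λ : lorentzGroup) (c₀ : E4) {M a c r₀ : ℝ} {Θ : E4 → E4}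
    (hrp : 0 < Kerr.rPlus M a) (hr₀ : r₀ < Kerr.rPlus M a) (hc : 0 < c)
    (hΘc : ContinuousOn Θ (Kerr.region a r₀ : Set E4))
    (hΘm : MapsTo Θ (Kerr.region a r₀ : Set E4) (A.domain : Set E4))
    (hΘe : ∀ x ∈ (Kerr.region a r₀ : Set E4), ∀ s : ℝ,
      Θ (x + s • E4.basisVector 0) = Θ x + (c * s) • E4.basisVector 0)
    (R : ℝ) :
    ∃ m Rt : ℝ, ∀ τ₁ : ℝ,
      (fun x ↦ (Λ : E4 ≃L[ℝ] E4) (Θ (poincareInv Λ c₀ x)) + c₀) ''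
          (Subtype.val '' (boostedKerrBackground Λ c₀ M a).truncLateRegion τ₁ R) ⊆
        Subtype.val '' (A.background.boost Λ c₀).truncLateRegion (c * τ₁ + m) Rt := by
  obtain ⟨C, hC⟩ := A.exists_abs_radius_sub_spatialNorm_le
  have hK : IsCompact ((fun u : E4 ↦ (Λ : E4 ≃L[ℝ] E4) u + c₀) ''
      {u : E4 | E4.time u = 0 ∧ Kerr.rPlus M a ≤ Kerr.radius a u ∧ Kerr.radius a u ≤ R}) :=
    (isCompact_kerrSlabPiece a hrp R).image (continuous_poincare Λ c₀)
  have hKs : (fun u : E4 ↦ (Λ : E4 ≃L[ℝ] E4) u + c₀) ''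
      {u : E4 | E4.time u = 0 ∧ Kerr.rPlus M a ≤ Kerr.radius a u ∧ Kerr.radius a u ≤ R} ⊆
        poincareInv Λ c₀ ⁻¹' (Kerr.region a r₀ : Set E4) := by
    rw [preimage_poincareInv_eq_image]
    exact image_mono (kerrSlabPiece_subset_region a (max_lt hr₀ hrp) R)
  have hΦc : ContinuousOn (fun x ↦ (Λ : E4 ≃L[ℝ] E4) (Θ (poincareInv Λ c₀ x)) + c₀)
      (poincareInv Λ c₀ ⁻¹' (Kerr.region a r₀ : Set E4)) :=
    ((Λ : E4 ≃L[ℝ] E4).continuous.comp_continuousOn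
      (hΘc.comp (continuous_poincareInv Λ c₀).continuousOn (mapsTo_preimage _ _))).add continuousOn_const
  obtain ⟨m, M', Rt, hwin⟩ := image_translate_subset_window hK hKs hΦc (conj_add_smul Λ c₀ hΘe)
    (continuous_movedTime Λ c₀) (movedTime_add_smul Λ c₀ c)
    (rad := fun u ↦ A.radius (poincareInv Λ c₀ u)) (continuous_movedSpatialNorm_add Λ c₀ C)
    (fun u ↦ by linarith [(abs_le.1 (hC (poincareInv Λ c₀ u))).2]) (movedRadius_add_smul Λ c₀ A c)
  refine ⟨m, Rt, fun τ₁ ↦ ?_⟩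
  rintro _ ⟨x, hx, rfl⟩
  rw [image_val_truncLateRegion_boostedKerr] at hx
  obtain ⟨hx1, hx2, hx3⟩ := hx
  -- `x` lies on the truncated slab at its own time, hence in a translate of the compact piece
  have hxs : x ∈ Subtype.val '' (boostedKerrBackground Λ c₀ M a).truncTimeSlab R ((poincareInv Λ c₀ x) 0) := by
    rw [image_val_truncTimeSlab_boostedKerr]
    exact ⟨hx1, rfl, hx3⟩
  have hw := hwin _ (mem_image_of_mem _ (truncTimeSlab_boostedKerr_subset_translate Λ c₀ M a R _ hxs))
  obtain ⟨⟨hlo, -⟩, hra⟩ := hw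
  have hreg : poincareInv Λ c₀ x ∈ (Kerr.region a r₀ : Set E4) :=
    Kerr.mem_region.2 ((max_lt hr₀ hrp).trans ((le_max_left _ _).trans_lt (Kerr.mem_exterior.1 hx1)))
  have ht : (Λ : E4 ≃L[ℝ] E4) (Θ (poincareInv Λ c₀ x)) + c₀ ∈ poincareInv Λ c₀ ⁻¹' (A.domain : Set E4) :=
    mapsTo_conj Λ c₀ hΘm hreg
  refine ⟨⟨_, ht⟩, ⟨?_, hra⟩, rfl⟩
  show c * τ₁ + m < (poincareInv Λ c₀ ((Λ : E4 ≃L[ℝ] E4) (Θ (poincareInv Λ c₀ x)) + c₀)) 0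
  have h1 : c * τ₁ < c * (poincareInv Λ c₀ x) 0 := mul_lt_mul_of_pos_left hx2 hc
  linarith

/-- **Registered helper `boostedKerr_truncSlab_pullback_tendsto_zero`** (binder-free form of
`tendsto_supCkENorm_boostedKerr_truncTimeSlab`; `0 < r₊` holds for sub-extremal `(M, a)`). [folklore] -/
theorem boostedKerr_truncSlab_pullback_tendsto_zero : ∀ (𝓑 : StationaryAFBlackHole.{0}) (A : 𝓑.AdaptedChart) (Λ : lorentzGroup) (c₀ : E4) (M a c r₀ : ℝ) (Θ : E4 → E4) (k : ℕ) (B : E4 → E4 →L[ℝ] E4 →L[ℝ] ℝ), Kerr.IsSubextremal M a → r₀ < Kerr.rPlus M a → 0 < c → ContDiffOn ℝ (k + 1) Θ (Kerr.region a r₀ : Set E4) → Set.MapsTo Θ (Kerr.region a r₀ : Set E4) (A.domain : Set E4) → (∀ x ∈ (Kerr.region a r₀ : Set E4), ∀ s : ℝ, Θ (x + s • E4.basisVector 0) = Θ x + (c * s) • E4.basisVector 0) → ContDiffOn ℝ k B (poincareInv Λ c₀ ⁻¹' (A.domain : Set E4)) → (∀ Rt : ℝ, Filter.Tendsto (fun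 σ ↦ supCkENorm (Subtype.val '' (A.background.boost Λ c₀).truncTimeSlab Rt σ) k B) Filter.atTop (nhds 0)) → ∀ R : ℝ, Filter.Tendsto (fun τ : ℝ ↦ supCkENorm (Subtype.val '' (boostedKerrBackground Λ c₀ M a).truncTimeSlab R τ) k (bilinPullback (fun x ↦ (Λ : E4 ≃L[ℝ] E4) (Θ (poincareInv Λ c₀ x)) + c₀) B)) Filter.atTop (nhds 0) :=
  fun _ A Λ c₀ _ _ _ _ _ _ _ hsub hr₀ hc hΘs hΘm hΘe hB hdev R ↦
    tendsto_supCkENorm_boostedKerr_truncTimeSlab A Λ c₀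
      (hsub.pos.trans_le (le_add_of_nonneg_right (Real.sqrt_nonneg _))) hr₀ hc hΘs hΘm hΘe hB hdev R

end Summit.FinalStateConjecture.FinalStateConjecture.Theorems.SymplecticDualOfTheBomb

end
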